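import Literature.NumberTheory.Automorphic.OrbitalIntegralLocallyConstantChart
import Literature.MeasureTheory.Group.QuotientAveraging
import HarnessLib

/-!
# Regular orbital integrals are locally constant along the torus — Harish-Chandra's argument from uniform compactness (generic layer,
# non-archimedean; N6ns-reg (ii)⊕(ii′) junction)

Topic `NumberTheory/Automorphic`; namespace `Literature.NumberTheory.Automorphic`. THEOREMS ONLY (no definition, no instance, no notation, no named
fact, no `sorry`). Cell `pub/hodgecm-mathlib`, programme P3a, road «N6-ns» (the non-split clause of letter N6), brick «(ii)+(ii′)-CM DRESS» FILE A (LEAD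
F0P3a-plan (g9) T8-23 (C)(2)): the CHART-FREE local constancy of regular orbital integrals for EVERY locally constant compactly supported test function,
from Harish-Chandra's uniform compactness (★ `ConjugationProperOnRegularCompacta`, whose conclusion is taken here as the hypothesis `hE`) and the
chart-local generic layer ★ `OrbitalIntegralLocallyConstantChart` (§2 tube lemma, §3 canonical-family reading).

THE MATHEMATICS [HarishChandra1970, Part I §3, Lemma 14 ⇒ Thm 13-type corollary]. `G` a topological group, `T ≤ G` («the torus»), `K ⊆ G` a set of
torus points centralised by `T` (`τ t = t τ`), `C ⊆ G` with `supp f ⊆ C`. HYPOTHESIS (ii′): `E = π{x ∈ G ∣ ∃ t ∈ K, x t x⁻¹ ∈ C}` is compact in `G ⧸ T`.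
Lift `E` inside `π(L)` for a compact `L ⊆ G` (★ `WeilQuotient.exists_isCompact_image_mk_superset`). For `t, t₀ ∈ K` the orbital integrands
`ẋ ↦ f(x t x⁻¹)`, `ẋ ↦ f(x t₀ x⁻¹)` vanish off `π(L)` and at `ẋ = π(l τ)`, `l ∈ L`, take the values `f(l t l⁻¹)`, `f(l t₀ l⁻¹)`; `f` locally constant makes
`(l, t) ↦ f(l t l⁻¹)` locally constant, hence (tube lemma over the compact `L`, ★ `exists_nhds_forall_comp_eq_of_isLocallyConstant`) `f(l t l⁻¹) = f(l t₀ l⁻¹)`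
for all `l ∈ L` once `t` is near `t₀`. So the two integrands are the SAME function on `G ⧸ T` — for ANY measure — and, read through a canonical family
(★ `OrbitalMeasureFamily.IsCanonical.classOrbitalIntegral_mk_eq_integral_descConj`), `Φ([t], f; m) = Φ([t₀], f; m)` for `t ∈ K` near `t₀`.

* §1 `descConj_eq_descConj_of_forall_conj_eq_of_subset_image_mk` ∕ `integral_descConj_eq_…` (pointwise ∕ integrated comparison, any measure);
* §2 `exists_nhds_forall_descConj_eq_of_isCompact_image_mk` ∕ `exists_nhds_forall_integral_descConj_eq_of_isCompact_image_mk` (the tube-lemma step under (ii′));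
* §3 **`OrbitalMeasureFamily.IsCanonical.exists_nhds_classOrbitalIntegral_mk_eq_of_isCompact_image_mk`** (canonical families, `K ⊆ {P ∧ Z(·) = T}`) and its
  `tsupport` form `…_of_isCompact_image_mk_tsupport`.
NOT here: the production of `hE` (★ p840074 at `GL_m(F)` ∕ `U(σ, J)(E)`; the CM dress transports it to `(cmDatum L N J).Local v`), charts, the glue (iii).
HONEST LABEL: HC_CM is proved only modulo the printed citations until rung 0 closes; this file is point-set topology and pays nothing by itself.

## References
* [HarishChandra1970] Harish-Chandra (notes by G. van Dijk), *Harmonic Analysis on Reductive p-adic Groups*, LNM 162 (1970), Part I §3, Lemmas 13–14.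
* [Rogawski1990] J. D. Rogawski, *Automorphic Representations of Unitary Groups in Three Variables*, Ann. of Math. Stud. 123 (1990), §4.3 p. 43; §4.9 p. 54.
* [DeitmarEchterhoff2014] A. Deitmar, S. Echterhoff, *Principles of Harmonic Analysis*, 2nd ed. (2014), Thm. 1.5.3, Lemma 9.3.3.
-/

set_option autoImplicit false

noncomputable section

open MeasureTheory Measure Set Filter Topology Literature.MeasureTheory.Group
open scoped Pointwise

namespace Literature.NumberTheory.Automorphic

/-! ## §1 Integrands supported in the image of a set `L ⊆ G` and agreeing along `L` are equal -/

section Pointwise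

variable {G : Type*} [Group G] {T : Subgroup G} {Y : Type*}

/-- **Pointwise comparison of two orbital integrands supported in `π(L)`**: `K` centralised by `T`, every `x` with `f(x t x⁻¹) ≠ 0` (`t ∈ K`) has
`π(x) ∈ π(L)`, and `f(l t l⁻¹) = f(l t₀ l⁻¹)` for `l ∈ L` (`t, t₀ ∈ K`) ⇒ `ẋ ↦ f(x t x⁻¹)` and `ẋ ↦ f(x t₀ x⁻¹)` are the SAME function on `G ⧸ T`.
[cite: HarishChandra1970, Part I §3 Lemma 14] -/
theorem descConj_eq_descConj_of_forall_conj_eq_of_subset_image_mk [Zero Y] {K : Set G} (hKT : ∀ t ∈ K, ∀ τ ∈ T, τ * t = t * τ)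
    (L : Set G) {f : G → Y}
    (hsupp : ∀ t ∈ K, ∀ x : G, f (x * t * x⁻¹) ≠ 0 → (QuotientGroup.mk x : G ⧸ T) ∈ (QuotientGroup.mk '' L : Set (G ⧸ T)))
    {t t₀ : G} (ht : t ∈ K) (ht₀ : t₀ ∈ K) (hconst : ∀ l ∈ L, f (l * t * l⁻¹) = f (l * t₀ * l⁻¹)) :
    descConj t T (hKT t ht) f = descConj t₀ T (hKT t₀ ht₀) f := by
  funext x
  induction x using QuotientGroup.induction_on with
  | H g =>
    rw [descConj_mk, descConj_mk]
    by_cases hg : (QuotientGroup.mk g : G ⧸ T) ∈ (QuotientGroup.mk '' L : Set (G ⧸ T))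
    · obtain ⟨l, hl, hlg⟩ := hg
      rw [QuotientGroup.eq] at hlg
      obtain ⟨τ, hτ, hgτ⟩ : ∃ τ ∈ T, g = l * τ := ⟨l⁻¹ * g, hlg, (mul_inv_cancel_left l g).symm⟩
      rw [hgτ, mul_mul_conj_eq_of_comm (hKT t ht τ hτ), mul_mul_conj_eq_of_comm (hKT t₀ ht₀ τ hτ)]
      exact hconst l hl
    · have h1 : f (g * t * g⁻¹) = 0 := by
        by_contra h
        exact hg (hsupp t ht g h)
      have h2 : f (g * t₀ * g⁻¹) = 0 := by
        by_contra h
        exact hg (hsupp t₀ ht₀ g h)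
      rw [h1, h2]

/-- The integrated form: `∫_{G⧸T} f(x t x⁻¹) dμ = ∫_{G⧸T} f(x t₀ x⁻¹) dμ` for ANY measure `μ` on `G ⧸ T`, under the hypotheses of
★ `descConj_eq_descConj_of_forall_conj_eq_of_subset_image_mk`. [cite: HarishChandra1970, Part I §3 Lemma 14] -/
theorem integral_descConj_eq_of_forall_conj_eq_of_subset_image_mk [NormedAddCommGroup Y] [NormedSpace ℝ Y] [MeasurableSpace (G ⧸ T)]
    (μ : Measure (G ⧸ T)) {K : Set G} (hKT : ∀ t ∈ K, ∀ τ ∈ T, τ * t = t * τ) (L : Set G) {f : G → Y}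
    (hsupp : ∀ t ∈ K, ∀ x : G, f (x * t * x⁻¹) ≠ 0 → (QuotientGroup.mk x : G ⧸ T) ∈ (QuotientGroup.mk '' L : Set (G ⧸ T)))
    {t t₀ : G} (ht : t ∈ K) (ht₀ : t₀ ∈ K) (hconst : ∀ l ∈ L, f (l * t * l⁻¹) = f (l * t₀ * l⁻¹)) :
    ∫ x, descConj t T (hKT t ht) f x ∂μ = ∫ x, descConj t₀ T (hKT t₀ ht₀) f x ∂μ := by
  rw [descConj_eq_descConj_of_forall_conj_eq_of_subset_image_mk hKT L hsupp ht ht₀ hconst]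

end Pointwise

/-! ## §2 The tube-lemma step under Harish-Chandra's uniform compactness -/

section Tube

variable {G : Type*} [Group G] [TopologicalSpace G] [IsTopologicalGroup G] [LocallyCompactSpace G] {T : Subgroup G} {Y : Type*}

/-- **THE ORBITAL INTEGRANDS OF A LOCALLY CONSTANT `f` ARE LOCALLY CONSTANT IN THE TORUS VARIABLE, AS FUNCTIONS ON `G ⧸ T`** (uniform compactness
⇒ local constancy). `K` centralised by `T`; (ii′) `E = π{x ∣ ∃ t ∈ K, x t x⁻¹ ∈ C}` compact; `f` locally constant with `supp f ⊆ C`; `t₀ ∈ K`. Then there is a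
neighbourhood `W` of `t₀` IN `G` with `ẋ ↦ f(x t x⁻¹)` EQUAL to `ẋ ↦ f(x t₀ x⁻¹)` for every `t ∈ W ∩ K` (lift `E ⊆ π(L)`, `L` compact, ★
`WeilQuotient.exists_isCompact_image_mk_superset`; tube lemma ★ `exists_nhds_forall_comp_eq_of_isLocallyConstant` for `(l, t) ↦ f(l t l⁻¹)` over `L`; §1).
[cite: HarishChandra1970, Part I §3 Lemmas 13–14] [cite: Rogawski1990, §4.9 p. 54] -/
theorem exists_nhds_forall_descConj_eq_of_isCompact_image_mk [Zero Y] {K : Set G} (hKT : ∀ t ∈ K, ∀ τ ∈ T, τ * t = t * τ)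
    {C : Set G} (hE : IsCompact (QuotientGroup.mk '' {x : G | ∃ t ∈ K, x * t * x⁻¹ ∈ C} : Set (G ⧸ T)))
    {f : G → Y} (hf : IsLocallyConstant f) (hfC : Function.support f ⊆ C) {t₀ : G} (ht₀ : t₀ ∈ K) :
    ∃ W ∈ 𝓝 t₀, ∀ t ∈ W, ∀ ht : t ∈ K, descConj t T (hKT t ht) f = descConj t₀ T (hKT t₀ ht₀) f := by
  obtain ⟨L, hL, hEL⟩ := WeilQuotient.exists_isCompact_image_mk_superset (H := T) hE
  have hF : IsLocallyConstant (f ∘ fun p : G × G => p.1 * p.2 * p.1⁻¹) :=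
    hf.comp_continuous ((continuous_fst.mul continuous_snd).mul continuous_fst.inv)
  obtain ⟨W, hW, hconst⟩ := exists_nhds_forall_comp_eq_of_isLocallyConstant (fun p : G × G => p.1 * p.2 * p.1⁻¹) hF hL t₀
  refine ⟨W, hW, fun t htW ht => ?_⟩
  refine descConj_eq_descConj_of_forall_conj_eq_of_subset_image_mk hKT L (fun s hs x hx => hEL ⟨x, ⟨s, hs, hfC hx⟩, rfl⟩) ht ht₀
    fun l hl => hconst l hl t htW

/-- The integrated form of ★ `exists_nhds_forall_descConj_eq_of_isCompact_image_mk`: for ANY measure `μ` on `G ⧸ T`,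
`∫ f(x t x⁻¹) dμ(ẋ) = ∫ f(x t₀ x⁻¹) dμ(ẋ)` for `t ∈ W ∩ K`. [cite: HarishChandra1970, Part I §3 Lemmas 13–14] [cite: Rogawski1990, §4.9 p. 54] -/
theorem exists_nhds_forall_integral_descConj_eq_of_isCompact_image_mk [NormedAddCommGroup Y] [NormedSpace ℝ Y] [MeasurableSpace (G ⧸ T)]
    (μ : Measure (G ⧸ T)) {K : Set G} (hKT : ∀ t ∈ K, ∀ τ ∈ T, τ * t = t * τ)
    {C : Set G} (hE : IsCompact (QuotientGroup.mk '' {x : G | ∃ t ∈ K, x * t * x⁻¹ ∈ C} : Set (G ⧸ T)))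
    {f : G → Y} (hf : IsLocallyConstant f) (hfC : Function.support f ⊆ C) {t₀ : G} (ht₀ : t₀ ∈ K) :
    ∃ W ∈ 𝓝 t₀, ∀ t ∈ W, ∀ ht : t ∈ K, ∫ x, descConj t T (hKT t ht) f x ∂μ = ∫ x, descConj t₀ T (hKT t₀ ht₀) f x ∂μ := by
  obtain ⟨W, hW, h⟩ := exists_nhds_forall_descConj_eq_of_isCompact_image_mk hKT hE hf hfC ht₀
  exact ⟨W, hW, fun t htW ht => by rw [h t htW ht]⟩

end Tube

/-! ## §3 The canonical-family reading -/

section Canonical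

variable {G : Type*} [Group G] [TopologicalSpace G] [IsTopologicalGroup G] [LocallyCompactSpace G]
  [SecondCountableTopology G] [T2Space G] [MeasurableSpace G] [BorelSpace G]
  [∀ γ : G, MeasurableSpace (G ⧸ Subgroup.centralizer ({γ} : Set G))]
  [∀ γ : G, BorelSpace (G ⧸ Subgroup.centralizer ({γ} : Set G))]
  {E : Type*} [NormedAddCommGroup E] [NormedSpace ℝ E]

/-- **N6ns-reg (ii)⊕(ii′), GENERIC FORM — THE CLASS ORBITAL INTEGRAL OF A CANONICAL FAMILY IS LOCALLY CONSTANT ALONG THE TORUS, FOR EVERY LOCALLY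
CONSTANT COMPACTLY SUPPORTED TEST FUNCTION.** `m` canonical for the conjugation-invariant predicate `P` and the Haar `ν`; `T ≤ G` closed with a
core-normalised Haar inversion-invariant `ρ`; `K` a set of `P`-points with `Z(t) = T` (`t ∈ K`); (ii′) `π{x ∣ ∃ t ∈ K, x t x⁻¹ ∈ C}` compact in
`G ⧸ T`; `f` locally constant with `supp f ⊆ C`; `t₀ ∈ K`. Then `Φ([t], f; m) = Φ([t₀], f; m)` for all `t ∈ K` in a neighbourhood of `t₀` (§2 + ★
`OrbitalMeasureFamily.IsCanonical.classOrbitalIntegral_mk_eq_integral_descConj` on both sides). [cite: HarishChandra1970, Part I §3 Lemmas 13–14]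
[cite: Rogawski1990, §4.3 (4.3.1) p. 43; §4.9 p. 54] [cite: DeitmarEchterhoff2014, Thm. 1.5.3] -/
theorem OrbitalMeasureFamily.IsCanonical.exists_nhds_classOrbitalIntegral_mk_eq_of_isCompact_image_mk
    {P : G → Prop} (hP : ∀ g x : G, P g → P (x * g * x⁻¹)) {ν : Measure G} [IsHaarMeasure ν] [ν.IsMulRightInvariant]
    {m : OrbitalMeasureFamily G} (hm : m.IsCanonical P ν)
    (T : Subgroup G) (hTc : IsClosed (T : Set G)) [MeasurableSpace (G ⧸ T)] [BorelSpace (G ⧸ T)]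
    (ρ : Measure ↥T) [IsHaarMeasure ρ] [ρ.IsInvInvariant] (hρ : ρ (compactCore ↥T) = 1)
    {K : Set G} (hreg : ∀ t ∈ K, P t ∧ Subgroup.centralizer ({t} : Set G) = T)
    {C : Set G} (hE : IsCompact (QuotientGroup.mk '' {x : G | ∃ t ∈ K, x * t * x⁻¹ ∈ C} : Set (G ⧸ T)))
    {f : G → E} (hf : IsLocallyConstant f) (hfC : Function.support f ⊆ C) {t₀ : G} (ht₀ : t₀ ∈ K) :
    ∃ W ∈ 𝓝 t₀, ∀ t ∈ W, t ∈ K → classOrbitalIntegral m f (ConjClasses.mk t) = classOrbitalIntegral m f (ConjClasses.mk t₀) := by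
  have hKT : ∀ t ∈ K, ∀ τ ∈ T, τ * t = t * τ := fun t ht τ hτ => by
    rw [← (hreg t ht).2] at hτ
    exact Subgroup.mem_centralizer_singleton_iff.1 hτ
  obtain ⟨W, hW, h⟩ := exists_nhds_forall_descConj_eq_of_isCompact_image_mk hKT hE hf hfC ht₀
  refine ⟨W, hW, fun t htW ht => ?_⟩
  rw [hm.classOrbitalIntegral_mk_eq_integral_descConj hP (hreg t ht).1 T hTc (hreg t ht).2 (hKT t ht) ρ hρ f,
    hm.classOrbitalIntegral_mk_eq_integral_descConj hP (hreg t₀ ht₀).1 T hTc (hreg t₀ ht₀).2 (hKT t₀ ht₀) ρ hρ f, h t htW ht]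

/-- The `tsupport` ∕ `HasCompactSupport`-free reading used by the CM dress: same conclusion with (ii′) stated at `C := tsupport f`.
[cite: HarishChandra1970, Part I §3 Lemmas 13–14] [cite: Rogawski1990, §4.9 p. 54] -/
theorem OrbitalMeasureFamily.IsCanonical.exists_nhds_classOrbitalIntegral_mk_eq_of_isCompact_image_mk_tsupport
    {P : G → Prop} (hP : ∀ g x : G, P g → P (x * g * x⁻¹)) {ν : Measure G} [IsHaarMeasure ν] [ν.IsMulRightInvariant]
    {m : OrbitalMeasureFamily G} (hm : m.IsCanonical P ν)
    (T : Subgroup G) (hTc : IsClosed (T : Set G)) [MeasurableSpace (G ⧸ T)] [BorelSpace (G ⧸ T)]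
    (ρ : Measure ↥T) [IsHaarMeasure ρ] [ρ.IsInvInvariant] (hρ : ρ (compactCore ↥T) = 1)
    {K : Set G} (hreg : ∀ t ∈ K, P t ∧ Subgroup.centralizer ({t} : Set G) = T) {f : G → E}
    (hE : IsCompact (QuotientGroup.mk '' {x : G | ∃ t ∈ K, x * t * x⁻¹ ∈ tsupport f} : Set (G ⧸ T)))
    (hf : IsLocallyConstant f) {t₀ : G} (ht₀ : t₀ ∈ K) :
    ∃ W ∈ 𝓝 t₀, ∀ t ∈ W, t ∈ K → classOrbitalIntegral m f (ConjClasses.mk t) = classOrbitalIntegral m f (ConjClasses.mk t₀) :=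
  hm.exists_nhds_classOrbitalIntegral_mk_eq_of_isCompact_image_mk hP T hTc ρ hρ hreg hE hf (subset_tsupport f) ht₀

end Canonical

end Literature.NumberTheory.Automorphic

end
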